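import Mathlib
import Literature.NumberTheory.Sieve.LinearDispersionEngine
import Literature.NumberTheory.Sieve.DispersionMoebiusMainTerm
import Literature.NumberTheory.Sieve.CoprimeMoebiusHarmonicDecay
import Literature.NumberTheory.Sieve.DispersionBoxTools
import HarnessLib

/-!
# One dyadic scale of the dispersion in boxes, and the Möbius main term

Topic `Literature/NumberTheory/Sieve`.  Two steps of the treatment of the bilinear form
`∑_{d} μ(d) log d ∑_{u} μ(tu) log(tu) ∑_{y} [u ∣ A d (c + Qy) + B]` (a `k = 2` linear divisor problem
with Möbius weights) by Linnik's dispersion method (Bombieri–Friedlander–Iwaniec 1986, §§3–6):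

* `scale_dispersion_le`: on a dyadic block `d ∼ R` in a fixed class `d ≡ c_d (mod Q)`, the sum over `d` of
  the squares of the inner sums is bounded through the smooth majorant `bump R (R/2)` by the output of the
  dispersion engine `LD_dispersion_engine` (main term + error term);
* `moebius_mainTerm_le`: the Möbius main term (`DispersionMainTerm.abs_mainTerm_le`) is, for `x` large,
  `≪ (log x) W + Q₀ (log x) W² (log x)^{−(2A+8)}`, the saving coming from the prime number theorem for `μ`
  (decay absorbed by `DispersionBox.decayFactor_le`).

## References
* E. Bombieri, J. B. Friedlander, H. Iwaniec, *Primes in arithmetic progressions to large moduli*,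
  Acta Math. 156 (1986), §§3–6.
-/

noncomputable section

open Finset Real MeasureTheory

namespace Literature.NumberTheory.Sieve

namespace DispersionBox


/-- **One dyadic scale through the dispersion engine.**  For a block `D_k ⊆ [R, 2R)` of the long variable
(in the class `c_d mod Q`), the quantity `∑_{d ∈ D_k} |∑_{u ∈ U} μ(tu) log(tu) ∑_y [u ∣ q₀ d (c_m + Qy) + B]|²`
(`U = {U₁ < u ≤ U₂ : u` squarefree, `(u, |q₀||B|Q) = 1}`, `U₂ ≤ 2U₁`) is at most the smoothed dispersion with
the weight `bump R (R/2) ≥ 1_{[R,2R]}`, which Linnik's dispersion method (`LD_dispersion_engine`) evaluates as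
main term + error; the main term is `(∫F)/Q ≤ 2R` times the Möbius double sum of
`DispersionMainTerm.abs_mainTerm_le` (normalised weights `μ(tu)log(tu)/L_t`, `L_t = 1 + log(tU₂)`).
[cite: BombieriFriedlanderIwaniecActa1986, §3 (3.6)–(3.8) and §6] -/
theorem scale_dispersion_le (q₀ B : ℤ) (hq₀ : q₀ ≠ 0) (hB : B ≠ 0) :
    ∃ Ke : ℝ, 0 < Ke ∧ ∀ (t Q U₁ U₂ : ℕ) (cd cm y₁ y₂ : ℤ) (T R : ℝ) (Dk : Finset ℕ),
      0 < t → 0 < Q → 1 ≤ U₁ → U₁ ≤ U₂ → U₂ ≤ 2 * U₁ → y₁ ≤ y₂ → 1 ≤ T → 1 ≤ R →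
      (∀ u ∈ (Finset.Ioc U₁ U₂).filter (fun u : ℕ =>
          Squarefree u ∧ Nat.Coprime u (q₀.natAbs * B.natAbs * Q)), ((Nat.divisors u).card : ℝ) ≤ T) →
      (∀ d ∈ Dk, R ≤ (d : ℝ) ∧ (d : ℝ) < 2 * R ∧ (d : ℤ) ≡ cd [ZMOD Q]) →
      ∑ d ∈ Dk, (∑ u ∈ (Finset.Ioc U₁ U₂).filter (fun u : ℕ =>
            Squarefree u ∧ Nat.Coprime u (q₀.natAbs * B.natAbs * Q)),
          ((ArithmeticFunction.moebius (t * u) : ℝ) * Real.log ((t * u : ℕ) : ℝ)) *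
            ∑ y ∈ Finset.Ioc y₁ y₂,
              (if (u : ℤ) ∣ q₀ * (d : ℤ) * (cm + (Q : ℤ) * y) + B then (1 : ℝ) else 0)) ^ 2 ≤
        (1 + Real.log ((t : ℝ) * U₂)) ^ 2 * (2 * R *
          |∑ u ∈ (Finset.Ioc U₁ U₂).filter (fun u => Squarefree u ∧ u.Coprime (q₀.natAbs * B.natAbs * Q)),
            ∑ u' ∈ (Finset.Ioc U₁ U₂).filter (fun u => Squarefree u ∧ u.Coprime (q₀.natAbs * B.natAbs * Q)),
              ((ArithmeticFunction.moebius (t * u) : ℝ) * Real.log ((t : ℝ) * u) /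
                  (1 + Real.log ((t : ℝ) * U₂))) *
              ((ArithmeticFunction.moebius (t * u') : ℝ) * Real.log ((t : ℝ) * u') /
                  (1 + Real.log ((t : ℝ) * U₂))) *
              ((((Finset.Ioc y₁ y₂) ×ˢ (Finset.Ioc y₁ y₂)).filter (fun p : ℤ × ℤ =>
                Int.gcd (cm + Q * p.1) u = 1 ∧ Int.gcd (cm + Q * p.2) u' = 1 ∧
                cm + Q * p.1 ≡ cm + Q * p.2 [ZMOD (Nat.gcd u u' : ℕ)])).card : ℝ) /
              ((Nat.lcm u u' : ℕ) : ℝ)| +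
          Ke * T ^ 4 * (1 + Real.log (2 * (U₁ : ℝ) * Q * R)) ^ 3 *
            (((Q : ℝ) * ((y₂ - y₁ : ℤ) + 1)) ^ 2 + (U₁ : ℝ) ^ 3)) := by
  obtain ⟨Ke, hKe, hEng⟩ := LD_dispersion_engine q₀ B 1 (8 * BFI.derivConst 2)
    hq₀ hB zero_le_one (by have := BFI.one_le_derivConst 2; positivity)
  refine ⟨Ke, hKe, ?_⟩
  intro t Q U₁ U₂ cd cm y₁ y₂ T R Dk ht hQ hU₁ hU₁₂ hU₂ hy hT hR hτ hDk
  set U : Finset ℕ := (Finset.Ioc U₁ U₂).filter (fun u : ℕ =>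
    Squarefree u ∧ Nat.Coprime u (q₀.natAbs * B.natAbs * Q)) with hUdef
  set Lt : ℝ := 1 + Real.log ((t : ℝ) * U₂) with hLt
  have hmemU : ∀ u ∈ U, U₁ < u ∧ u ≤ U₂ ∧ Squarefree u ∧ Nat.Coprime u (q₀.natAbs * B.natAbs * Q) :=
    fun u hu => by
      simp only [hUdef, Finset.mem_filter, Finset.mem_Ioc] at hu
      exact ⟨hu.1.1, hu.1.2, hu.2.1, hu.2.2⟩
  have hU₂pos : 0 < U₂ := by omega
  have htr : (1 : ℝ) ≤ t := by exact_mod_cast ht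
  have htU₂ : (1 : ℝ) ≤ (t : ℝ) * U₂ :=
    one_le_mul_of_one_le_of_one_le htr (by exact_mod_cast hU₂pos)
  have hLt1 : 1 ≤ Lt := by have := Real.log_nonneg htU₂; rw [hLt]; linarith only [this]
  have hLt0 : 0 < Lt := by linarith only [hLt1]
  have hU₁r : (1 : ℝ) ≤ U₁ := by exact_mod_cast hU₁
  have hU₂2U₁r : (U₂ : ℝ) ≤ 2 * U₁ := by exact_mod_cast hU₂
  have hR0 : 0 < R := by linarith only [hR]
  have hQr1 : (1 : ℝ) ≤ Q := by exact_mod_cast hQ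
  -- the normalised weights
  set a : ℕ → ℝ := fun u => if u ≤ U₂ then
    (ArithmeticFunction.moebius (t * u) : ℝ) * Real.log ((t : ℝ) * u) / Lt else 0 with ha
  have ha_le : ∀ u, |a u| ≤ 1 := fun u => by
    simp only [ha]
    split_ifs with hu
    · exact abs_moebius_mul_log_div_le_one ht hu (le_refl _)
    · simp
  have haU : ∀ u ∈ U, a u = (ArithmeticFunction.moebius (t * u) : ℝ) * Real.log ((t : ℝ) * u) / Lt :=
    fun u hu => by simp only [ha, if_pos (hmemU u hu).2.1]
  have haw : ∀ u ∈ U, (ArithmeticFunction.moebius (t * u) : ℝ) * Real.log ((t * u : ℕ) : ℝ) = Lt * a u :=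
    fun u hu => by rw [haU u hu]; push_cast; field_simp
  -- the smooth weight
  obtain ⟨hF1, hF2, hF3, hF4, hF5, hF6, hF7⟩ := bump_dispersion_hyps hR0
  set F : ℝ → ℝ := BFI.bump R (R / 2) with hFdef
  -- the engine
  have hUhyp : ∀ u ∈ U, Squarefree u ∧ Nat.Coprime u (q₀.natAbs * B.natAbs * Q) ∧ (U₁ : ℝ) < u ∧
      (u : ℝ) ≤ 2 * U₁ ∧ ((Nat.divisors u).card : ℝ) ≤ T := fun u hu => by
    obtain ⟨h1, h2, h3, h4⟩ := hmemU u hu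
    exact ⟨h3, h4, by exact_mod_cast h1, le_trans (by exact_mod_cast h2) hU₂2U₁r, hτ u hu⟩
  have hαhyp : ∀ u, ‖((a u : ℝ) : ℂ)‖ ≤ 1 := fun u => by
    rw [Complex.norm_real, Real.norm_eq_abs]; exact ha_le u
  have hE := hEng Q cd cm (U₁ : ℝ) R T y₁ y₂ U (fun u => ((a u : ℝ) : ℂ)) F hQ hU₁r hR hT hy
    hUhyp hαhyp hF1 hF2 hF3 hF4 hF5
  beta_reduce at hE
  rw [norm_dispersion_ofReal] at hE
  set Dr : ℝ := ∑ d ∈ (Finset.range (⌊4 * R⌋₊ + 1)).filter (fun d : ℕ => (d : ℤ) ≡ cd [ZMOD Q]),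
    F d * (∑ u ∈ U, a u * ∑ y ∈ Finset.Ioc y₁ y₂,
      (if (u : ℤ) ∣ q₀ * d * (cm + Q * y) + B then (1 : ℝ) else 0)) ^ 2 with hDr
  set MTr : ℝ := (∫ x, F x) / (Q : ℝ) *
    ∑ u ∈ U, ∑ u' ∈ U, a u * a u' *
      ((((Finset.Ioc y₁ y₂) ×ˢ (Finset.Ioc y₁ y₂)).filter (fun p : ℤ × ℤ =>
          Int.gcd (cm + Q * p.1) u = 1 ∧ Int.gcd (cm + Q * p.2) u' = 1 ∧
          cm + Q * p.1 ≡ cm + Q * p.2 [ZMOD (Nat.gcd u u' : ℕ)])).card : ℝ) /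
      ((Nat.lcm u u' : ℕ) : ℝ) with hMTr
  set Err : ℝ := Ke * T ^ 4 * (1 + Real.log (2 * (U₁ : ℝ) * Q * R)) ^ 3 *
    (((Q : ℝ) * ((y₂ - y₁ : ℤ) + 1)) ^ 2 + (U₁ : ℝ) ^ 3) with hErr
  have hDrle : Dr ≤ |MTr| + Err := by
    have h1 := (abs_sub_le_iff.mp hE).1
    linarith only [h1, le_abs_self MTr]
  -- `∑_{D_k} S² = L_t² ∑_{D_k} S_a² ≤ L_t² 𝒟`
  have hSd : ∀ d : ℕ, (∑ u ∈ U, ((ArithmeticFunction.moebius (t * u) : ℝ) * Real.log ((t * u : ℕ) : ℝ)) *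
      ∑ y ∈ Finset.Ioc y₁ y₂, (if (u : ℤ) ∣ q₀ * (d : ℤ) * (cm + (Q : ℤ) * y) + B then (1 : ℝ) else 0)) =
      Lt * (∑ u ∈ U, a u * ∑ y ∈ Finset.Ioc y₁ y₂,
        (if (u : ℤ) ∣ q₀ * d * (cm + Q * y) + B then (1 : ℝ) else 0)) := fun d => by
    rw [Finset.mul_sum]
    refine Finset.sum_congr rfl fun u hu => ?_
    rw [haw u hu]; ring
  have hDkDF : Dk ⊆ (Finset.range (⌊4 * R⌋₊ + 1)).filter (fun d : ℕ => (d : ℤ) ≡ cd [ZMOD Q]) := by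
    intro d hd
    obtain ⟨_, hd2, hd3⟩ := hDk d hd
    rw [Finset.mem_filter, Finset.mem_range]
    exact ⟨Nat.lt_succ_of_le (Nat.le_floor (by linarith only [hd2])), hd3⟩
  have hkey : ∑ d ∈ Dk, (∑ u ∈ U, ((ArithmeticFunction.moebius (t * u) : ℝ) * Real.log ((t * u : ℕ) : ℝ)) *
      ∑ y ∈ Finset.Ioc y₁ y₂, (if (u : ℤ) ∣ q₀ * (d : ℤ) * (cm + (Q : ℤ) * y) + B then (1 : ℝ) else 0)) ^ 2 ≤
      Lt ^ 2 * Dr := by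
    have h1 : ∑ d ∈ Dk, (∑ u ∈ U, ((ArithmeticFunction.moebius (t * u) : ℝ) * Real.log ((t * u : ℕ) : ℝ)) *
        ∑ y ∈ Finset.Ioc y₁ y₂, (if (u : ℤ) ∣ q₀ * (d : ℤ) * (cm + (Q : ℤ) * y) + B then (1 : ℝ) else 0)) ^ 2 =
        Lt ^ 2 * ∑ d ∈ Dk, (∑ u ∈ U, a u * ∑ y ∈ Finset.Ioc y₁ y₂,
          (if (u : ℤ) ∣ q₀ * d * (cm + Q * y) + B then (1 : ℝ) else 0)) ^ 2 := by
      rw [Finset.mul_sum]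
      refine Finset.sum_congr rfl fun d _ => ?_
      rw [hSd d]; ring
    rw [h1]
    refine mul_le_mul_of_nonneg_left ?_ (sq_nonneg _)
    rw [hDr]
    calc ∑ d ∈ Dk, (∑ u ∈ U, a u * ∑ y ∈ Finset.Ioc y₁ y₂,
            (if (u : ℤ) ∣ q₀ * d * (cm + Q * y) + B then (1 : ℝ) else 0)) ^ 2
        = ∑ d ∈ Dk, F d * (∑ u ∈ U, a u * ∑ y ∈ Finset.Ioc y₁ y₂,
            (if (u : ℤ) ∣ q₀ * d * (cm + Q * y) + B then (1 : ℝ) else 0)) ^ 2 := by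
          refine Finset.sum_congr rfl fun d hd => ?_
          rw [hF6 d (hDk d hd).1 (hDk d hd).2.1.le, one_mul]
      _ ≤ _ := Finset.sum_le_sum_of_subset_of_nonneg hDkDF
          (fun d _ _ => mul_nonneg (hF3 d) (sq_nonneg _))
  -- the main term
  have hMTeq : ∑ u ∈ U, ∑ u' ∈ U, a u * a u' *
      ((((Finset.Ioc y₁ y₂) ×ˢ (Finset.Ioc y₁ y₂)).filter (fun p : ℤ × ℤ =>
          Int.gcd (cm + Q * p.1) u = 1 ∧ Int.gcd (cm + Q * p.2) u' = 1 ∧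
          cm + Q * p.1 ≡ cm + Q * p.2 [ZMOD (Nat.gcd u u' : ℕ)])).card : ℝ) /
      ((Nat.lcm u u' : ℕ) : ℝ) =
      ∑ u ∈ U, ∑ u' ∈ U,
        ((ArithmeticFunction.moebius (t * u) : ℝ) * Real.log ((t : ℝ) * u) / Lt) *
        ((ArithmeticFunction.moebius (t * u') : ℝ) * Real.log ((t : ℝ) * u') / Lt) *
      ((((Finset.Ioc y₁ y₂) ×ˢ (Finset.Ioc y₁ y₂)).filter (fun p : ℤ × ℤ =>
          Int.gcd (cm + Q * p.1) u = 1 ∧ Int.gcd (cm + Q * p.2) u' = 1 ∧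
          cm + Q * p.1 ≡ cm + Q * p.2 [ZMOD (Nat.gcd u u' : ℕ)])).card : ℝ) /
      ((Nat.lcm u u' : ℕ) : ℝ) :=
    Finset.sum_congr rfl fun u hu => Finset.sum_congr rfl fun u' hu' => by rw [haU u hu, haU u' hu']
  have hint0 : 0 ≤ ∫ x, F x := MeasureTheory.integral_nonneg hF3
  have hint : (∫ x, F x) / Q ≤ 2 * R := (div_le_self hint0 hQr1).trans hF7
  have hMTrle : |MTr| ≤ 2 * R * |∑ u ∈ U, ∑ u' ∈ U,
        ((ArithmeticFunction.moebius (t * u) : ℝ) * Real.log ((t : ℝ) * u) / Lt) *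
        ((ArithmeticFunction.moebius (t * u') : ℝ) * Real.log ((t : ℝ) * u') / Lt) *
      ((((Finset.Ioc y₁ y₂) ×ˢ (Finset.Ioc y₁ y₂)).filter (fun p : ℤ × ℤ =>
          Int.gcd (cm + Q * p.1) u = 1 ∧ Int.gcd (cm + Q * p.2) u' = 1 ∧
          cm + Q * p.1 ≡ cm + Q * p.2 [ZMOD (Nat.gcd u u' : ℕ)])).card : ℝ) /
      ((Nat.lcm u u' : ℕ) : ℝ)| := by
    rw [hMTr, abs_mul, abs_of_nonneg (div_nonneg hint0 (Nat.cast_nonneg _)), hMTeq]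
    exact mul_le_mul_of_nonneg_right hint (abs_nonneg _)
  -- conclusion
  calc _ ≤ Lt ^ 2 * Dr := hkey
    _ ≤ Lt ^ 2 * (|MTr| + Err) := mul_le_mul_of_nonneg_left hDrle (sq_nonneg _)
    _ ≤ _ := by
        rw [hLt, hErr]
        refine mul_le_mul_of_nonneg_left (add_le_add hMTrle le_rfl) (sq_nonneg _)

/-- **The Möbius main term on one box.**  For `x` large (in terms of `σ₁, A` and the level `N₀`), the
double sum of `DispersionMainTerm.abs_mainTerm_le` attached to `U = {U₁ < u ≤ U₂ : u` squarefree, `(u,G)=1}`,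
`U₁ ≥ x^{σ₁}/(2N₀)`, `U₂ ≤ x`, level `t ≤ N₀`, `G ≤ N₀²`, moduli `Q ≤ Q₀`, and `m = c_m + Qy ∈ (0, x²]`,
`#y ≤ W ≤ 2x²`, is at most `4(1+log x)W + 4Q₀(1+log x)W²(1+log x)^{−(2A+8)}`: the coprimality factors are
`≤ exp(48(log x+1)^{1/4})` (moduli `≤ x⁴`), and the decay `exp(−2c₀√log⌊√U₁⌋) + U₁^{−1/2}` beats every power
of `log x`. [folklore] -/
theorem moebius_mainTerm_le (σ₁ A : ℝ) (hσ₁ : 0 < σ₁) (N₀ : ℕ) (hN₀ : 0 < N₀) :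
    ∃ Λ : ℝ, 1 ≤ Λ ∧ ∀ (x : ℝ) (t G U₁ U₂ Q : ℕ) (cm y₁ y₂ : ℤ) (W Q₀ : ℝ),
      Λ ≤ Real.log x → 1 ≤ x → 0 < t → (t : ℝ) ≤ N₀ → 0 < G → (G : ℝ) ≤ (N₀ : ℝ) * N₀ →
      (N₀ : ℝ) ^ 3 ≤ x → 1 ≤ U₁ → U₁ ≤ U₂ → U₂ ≤ 2 * U₁ → (U₂ : ℝ) ≤ x →
      x ^ σ₁ / (2 * N₀) ≤ U₁ → 0 < Q → (Q : ℝ) ≤ Q₀ → y₁ ≤ y₂ → ((y₂ - y₁ : ℤ) : ℝ) ≤ W → 1 ≤ W →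
      W ≤ 2 * x ^ 2 →
      (∀ y ∈ Finset.Ioc y₁ y₂, 0 < cm + Q * y ∧ ((cm + Q * y : ℤ) : ℝ) ≤ x ^ 2) →
      |∑ u ∈ (Finset.Ioc U₁ U₂).filter (fun u => Squarefree u ∧ u.Coprime G),
        ∑ u' ∈ (Finset.Ioc U₁ U₂).filter (fun u => Squarefree u ∧ u.Coprime G),
          ((ArithmeticFunction.moebius (t * u) : ℝ) * Real.log ((t : ℝ) * u) /
              (1 + Real.log ((t : ℝ) * U₂))) *
          ((ArithmeticFunction.moebius (t * u') : ℝ) * Real.log ((t : ℝ) * u') /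
              (1 + Real.log ((t : ℝ) * U₂))) *
            ((((Finset.Ioc y₁ y₂) ×ˢ (Finset.Ioc y₁ y₂)).filter (fun p : ℤ × ℤ =>
                Int.gcd (cm + Q * p.1) u = 1 ∧ Int.gcd (cm + Q * p.2) u' = 1 ∧
                cm + Q * p.1 ≡ cm + Q * p.2 [ZMOD (Nat.gcd u u' : ℕ)])).card : ℝ) /
            ((Nat.lcm u u' : ℕ) : ℝ)| ≤
        4 * (1 + Real.log x) * W + 4 * Q₀ * (1 + Real.log x) * W ^ 2 * (1 + Real.log x) ^ (-(2 * A + 8)) := by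
  obtain ⟨c₀, hc₀, C, hC, hMT⟩ := DispersionMainTerm.abs_mainTerm_le
  have hN₀r : (1 : ℝ) ≤ N₀ := by exact_mod_cast hN₀
  set Nexp : ℝ := 2 * A + 8 with hNexp
  obtain ⟨Λ₁, hΛ₁, hdec1⟩ := exp_quarter_sub_sqrt_le (2 * (18 * C ^ 2)) 96 Nexp
    (c₂ := c₀ * Real.sqrt σ₁) (by positivity)
  obtain ⟨Λ₂, hΛ₂, hdec2⟩ := exp_quarter_sub_lin_le (2 * (16 * Real.sqrt (2 * N₀))) 0 Nexp
    (c₂ := σ₁ / 2) (by positivity) (by positivity)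
  refine ⟨max (max Λ₁ Λ₂) (max 1 (max ((2 * Real.log (2 * N₀) + 4 * Real.log 2) / σ₁)
    (Real.log (8 * N₀) / σ₁))), le_trans (le_max_left _ _) (le_max_right _ _), ?_⟩
  intro x t G U₁ U₂ Q cm y₁ y₂ W Q₀ hΛ hx ht htN hG hGN hxN hU₁ hU₁₂ hU₂ hU₂x hVU hQ hQQ₀ hy hYW hW hWx hm
  simp only [max_le_iff] at hΛ
  obtain ⟨⟨hΛ₁L, hΛ₂L⟩, hL1, hΛ₅L, hΛ₆L⟩ := hΛ
  set Lx : ℝ := Real.log x with hLx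
  have hx0 : 0 < x := by linarith only [hx]
  have hLx0 : 0 ≤ Lx := Real.log_nonneg hx
  set L₀ : ℝ := 1 + Lx with hL₀
  have hL₀1 : 1 ≤ L₀ := by rw [hL₀]; linarith only [hLx0]
  have hL₀pos : 0 < L₀ := by linarith only [hL₀1]
  have hU₂pos : 0 < U₂ := by omega
  have htr : (1 : ℝ) ≤ t := by exact_mod_cast ht
  have hQr1 : (1 : ℝ) ≤ Q := by exact_mod_cast hQ
  set Lt : ℝ := 1 + Real.log ((t : ℝ) * U₂) with hLt
  have hm0 : ∀ y ∈ Finset.Ioc y₁ y₂, cm + Q * y ≠ 0 := fun y hy => (hm y hy).1.ne'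
  -- the coprimality factors
  set Bx : ℝ := Real.exp (48 * (Lx + 1) ^ (1 / 4 : ℝ)) with hBx
  have hBx1 : 1 ≤ Bx := Real.one_le_exp (by positivity)
  have hBhyp : ∀ y ∈ Finset.Ioc y₁ y₂, ∀ r : ℕ, 1 ≤ r → r ≤ U₂ →
      Real.exp (4 * ∑ p ∈ (t * r * G * (cm + Q * y).natAbs).primeFactors, (p : ℝ) ^ (-(3 / 4 : ℝ))) ≤
        Bx := by
    intro y hy r hr hrU
    obtain ⟨hm1, hm2⟩ := hm y hy
    set k : ℕ := t * r * G * (cm + Q * y).natAbs with hk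
    have hmabs : ((cm + Q * y).natAbs : ℝ) ≤ x ^ 2 := by
      have h0 : (0 : ℝ) < ((cm + Q * y : ℤ) : ℝ) := by exact_mod_cast hm1
      rw [Nat.cast_natAbs, Int.cast_abs, abs_of_pos h0]; exact hm2
    have hk1 : 1 ≤ k := by
      have : 0 < (cm + Q * y).natAbs := Int.natAbs_pos.mpr (hm0 y hy)
      have : 0 < k := by positivity
      omega
    have hkx : (k : ℝ) ≤ x ^ (4 : ℝ) := by
      have hrx : (r : ℝ) ≤ x := le_trans (by exact_mod_cast hrU) hU₂x
      calc (k : ℝ) = (t : ℝ) * r * G * (cm + Q * y).natAbs := by rw [hk]; push_cast; ring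
        _ ≤ (N₀ : ℝ) * x * ((N₀ : ℝ) * N₀) * x ^ 2 := by
            apply mul_le_mul (mul_le_mul (mul_le_mul htN hrx (by positivity) (by positivity)) hGN
              (by positivity) (by positivity)) hmabs (by positivity) (by positivity)
        _ = (N₀ : ℝ) ^ 3 * x ^ 3 := by ring
        _ ≤ x * x ^ 3 := mul_le_mul_of_nonneg_right hxN (by positivity)
        _ = x ^ (4 : ℝ) := by
            rw [show (4 : ℝ) = ((4 : ℕ) : ℝ) by norm_num, Real.rpow_natCast]; ring
    have hps := CoprimeMoebiusDecay.primeSum_le_of_le_rpow (B := 4) (by norm_num) hk1 hx hkx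
    rw [hBx, Real.exp_le_exp]
    have : (Real.log x + 1) ^ (1 / 4 : ℝ) = (Lx + 1) ^ (1 / 4 : ℝ) := by rw [hLx]
    rw [this] at hps
    linarith only [hps]
  -- the main-term bound
  have hMTb := hMT t G U₁ U₂ Q Lt Bx cm y₁ y₂ ht hG hU₁ hU₁₂ hU₂ hQ hy (le_refl _) hBx1 hm0 hBhyp
  -- the decay factor
  have hVU' : Real.exp (σ₁ * Lx) / (2 * N₀) ≤ U₁ := by
    have h1 : Real.exp (σ₁ * Lx) = x ^ σ₁ := by rw [Real.rpow_def_of_pos hx0, mul_comm]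
    rw [h1]; exact hVU
  have hdecU : 18 * C ^ 2 * Bx ^ 2 * Real.exp (-(2 * c₀) * Real.sqrt (Real.log (Nat.sqrt U₁ : ℝ))) +
      16 / Real.sqrt U₁ ≤ L₀ ^ (-Nexp) := by
    have := decayFactor_le (C := C) (Nexp := Nexp) (U₁ := U₁) hc₀ hσ₁ hN₀r hdec1 hdec2 hΛ₁L hΛ₂L
      hΛ₅L hΛ₆L hVU'
    simpa only [hBx, hL₀] using this
  set dec : ℝ := L₀ ^ (-Nexp) with hdecdef
  -- elementary bounds
  have hY0 : (0 : ℝ) ≤ ((y₂ - y₁ : ℤ) : ℝ) := by exact_mod_cast sub_nonneg.mpr hy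
  have hW0 : 0 ≤ W := by linarith only [hW]
  have h1 : 1 + Real.log (U₂ : ℝ) ≤ L₀ := by
    rw [hL₀]; have := Real.log_le_log (by positivity) hU₂x; linarith only [this]
  have h1' : 0 ≤ 1 + Real.log (U₂ : ℝ) := by
    have := Real.log_natCast_nonneg U₂; linarith only [this]
  have h2 : ((Nat.divisors Q).card : ℝ) ≤ Q₀ :=
    le_trans (by exact_mod_cast Nat.card_divisors_le_self Q) hQQ₀
  have hlogY0 : 0 ≤ Real.log ((y₂ - y₁ : ℤ) : ℝ) := by
    have h := Int.toNat_of_nonneg (sub_nonneg.mpr hy)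
    have : ((y₂ - y₁ : ℤ) : ℝ) = ((y₂ - y₁).toNat : ℕ) := by exact_mod_cast h.symm
    rw [this]; exact Real.log_natCast_nonneg _
  have h3 : 1 + Real.log ((y₂ - y₁ : ℤ) : ℝ) ≤ 2 * L₀ := by
    rcases eq_or_lt_of_le hY0 with h | h
    · rw [← h, Real.log_zero]; linarith only [hL₀1]
    · have e2 : Real.log (2 * x ^ 2) = Real.log 2 + 2 * Lx := by
        rw [Real.log_mul (by norm_num) (by positivity), Real.log_pow, hLx]; push_cast; ring
      have := Real.log_le_log h (hYW.trans hWx)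
      rw [e2] at this
      have hl2 : Real.log 2 < 1 := by
        have := Real.log_two_lt_d9; linarith only [this]
      rw [hL₀]; linarith only [this, hl2]
  have h3' : 0 ≤ 1 + Real.log ((y₂ - y₁ : ℤ) : ℝ) := by linarith only [hlogY0]
  have h4 : ((y₂ - y₁ : ℤ) : ℝ) ^ 2 ≤ W ^ 2 := pow_le_pow_left₀ hY0 hYW 2
  have hd0 : 0 ≤ 18 * C ^ 2 * Bx ^ 2 * Real.exp (-(2 * c₀) * Real.sqrt (Real.log (Nat.sqrt U₁ : ℝ))) +
      16 / Real.sqrt U₁ := by positivity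
  have e1 : 4 * ((y₂ - y₁ : ℤ) : ℝ) * (1 + Real.log U₂) ≤ 4 * W * L₀ := by
    have := mul_le_mul hYW h1 h1' hW0; linarith only [this]
  have e2 : 2 * ((Nat.divisors Q).card : ℝ) * ((y₂ - y₁ : ℤ) : ℝ) ^ 2 *
      (1 + Real.log ((y₂ - y₁ : ℤ) : ℝ)) *
      (18 * C ^ 2 * Bx ^ 2 * Real.exp (-(2 * c₀) * Real.sqrt (Real.log (Nat.sqrt U₁ : ℝ))) +
        16 / Real.sqrt U₁) ≤ 2 * Q₀ * W ^ 2 * (2 * L₀) * dec := by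
    have hQ₀0 : 0 ≤ Q₀ := le_trans (by positivity) hQQ₀
    apply mul_le_mul _ hdecU hd0 (by positivity)
    apply mul_le_mul _ h3 h3' (by positivity)
    apply mul_le_mul _ h4 (by positivity) (by positivity)
    linarith only [h2]
  refine hMTb.trans ?_
  rw [hdecdef, hNexp, hL₀] at e2
  rw [hL₀] at e1
  linarith only [e1, e2]


end DispersionBox

end Literature.NumberTheory.Sieve
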